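import Mathlib

-- `Summit.HodgeConjecture.HodgeConjecture.…` (summit = sub-problem for this single-conjunct summit) trips `linter.dupNamespace`
-- on every declaration; the duplication is the tree's naming convention (D-0017), as in the sibling census sheets.
set_option linter.dupNamespace false

/-!
# Hodge-locus census — the stencil identities behind the P-uniform closed forms of ENGINE B's exact-level Gross–Keating weight
# (ENGINE B, abs-2, gen 59; item (i) of ruling R-L300 (c); label fixed by R-L304 (b); record `DERIVATIONS_engineB.md` §69.34)

certified instances and evidence bearing on the general Hodge conjecture; no claim.

Def-free; imports Mathlib only; sorry-free; no `native_decide`; every identity holds for ALL parameters (`p, t` arbitrary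
integers, levels arbitrary naturals — no prime is special).  LABEL (R-L304 (b)): 'kernel-checked algebra of the stencil
identities (closed geometric sums over ℕ/ℤ parameters) = the algebraic step of B's derivation; the realisability lemma and the
modelling of v_ℓ(Res) by the GK machine are NOT in the kernel'.

OBJECTS (cell conventions, `g58/l7/quatp.py: nu`, doubled to stay in `ℤ`).  The local multiplicity of [KRY06, Cor. 6.1.2]
(S. Kudla, M. Rapoport, T. Yang, *Modular forms and special cycles on Shimura curves*, Ann. of Math. Stud. 161 (2006); `p` odd)
as a function of the first Gross–Keating invariant `a₁` and of `s = a₁ + a₂`: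
`Φ(2m+1, s) = Σ_{j ≤ m} (s − 4j) p^j`,  `Φ(2m, s) = Σ_{j < m} (s − 4j) p^j + ((s − 4m + 1)/2) p^m`.
In every theorem below `Φ : ℕ → ℤ → ℤ` is ANY function satisfying the doubled defining clauses
`hodd : Φ (2m+1) s = 2 Σ_{j<m+1} (s − 4j) p^j` and/or `heven : Φ (2m) s = 2 Σ_{j<m} (s − 4j) p^j + (s − 4m + 1) p^m`
(so `Φ = 2·ν`; the clauses determine `Φ` on all of `ℕ × ℤ`, no definition is introduced).  For a pair of sides of kinds
`k₁, k₂ ∈ {R, U}` (`e_i = 1` for R = "p ∣ N(y_i)", `e_i = 0` for U) scaled to levels `(S₁, S₂)` the Gross–Keating data are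
`a₁ = min(2S₁+e₁, 2S₂+e₂)`, `s = 2S₁ + 2S₂ + t` (`t = v_p(N₁N₂ − B²)`; §69.34 STEP 1: on admissible patterns the third candidate
`S₁+S₂+v_p(B)` never undercuts), and `F : ℕ → ℕ → ℤ` is ANY function with `hF : F S₁ S₂ = Φ (min (2S₁+e₁) (2S₂+e₂)) (2S₁+2S₂+t)`
(= twice the level-`(S₁,S₂)` multiplicity).  The EXACT-LEVEL weight at levels `L_i = M_i + 1 ≥ 1` is the double difference;
every conclusion below is `2w = F(L₁,L₂) − F(L₁−1,L₂) − F(L₁,L₂−1) + F(L₁−1,L₂−1)` in closed form: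

* `stencil_tie_R`  R-tie `(R,L)|(R,L)`:            `2w = 2·t·p^L`;
* `stencil_tie_U`  U-tie `(U,L)|(U,L)`:            `2w = p^{L−1}((p+1)t + p + 3)`;
* `stencil_adj_RU` `(R,L)|(U,L+1)`:                `2w = (t+3)p^L`            (`_one`: at `t = 1`, `2w = 2·φ(R,L)`);
* `stencil_adj_UR` `(U,L)|(R,L)`:                  `2w = 2(p+1)p^{L−1} + (t−1)p^L` (`_one`: at `t = 1`, `2w = 2·φ(U,L)`);
* `stencil_sep_R`  `(R,L₁)|(k₂,L₂)`, `2L₁+1 ≤ 2(L₂−1)+e₂`:  `2w = 4p^{L₁} = 2·φ(R,L₁)`, any `t`;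
* `stencil_sep_U`  `(U,L₁)|(k₂,L₂)`, `2L₁ ≤ 2(L₂−1)+e₂`:    `2w = 2(p+1)p^{L₁−1} = 2·φ(U,L₁)`, any `t`;
* `stencil_sep_R'`, `stencil_sep_U'`: the mirror cases (lower side on the right),
where `φ(R,L) = 2p^L`, `φ(U,L) = (p+1)p^{L−1}`.  With the realisability lemma of §69.34 (RU forces `t = 1`; UU has `t` odd;
RR has `t ≥ 2` — NOT in the kernel) these give the closed forms of record (R-L300 (b) / R-L304 (a)): off-tie
`w = min(φ(k₁,L₁), φ(k₂,L₂))`, R-tie `w = p^L·t`, U-tie `w = p^{L−1}((p+1)t+p+3)/2`.  The two ingredients of the hand derivation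
are the lemmas `sum_affine` ((A): the sums are affine in `s`) and `Finset.sum_range_succ` ((B): one-step differences); each
identity is then closed by `ring`.  Other implementations (cell rule): B's hand derivation §69.34, B's exhaustive exact box check
`g59/cf/CF-BOX-p23-L25-t30.txt` (450 000 cells), the LEAD's independent transcription check (34 875 admissible cells).
-/

namespace Summit.HodgeConjecture.HodgeConjecture.HodgeLocus.Census.GKStencilClosedForms

open Finset

/-- (A) of §69.34: the [KRY06]-type sum is affine in `s`. -/
theorem sum_affine (p s : ℤ) (n : ℕ) :
    ∑ j ∈ range n, (s - 4 * (j : ℤ)) * p ^ j = s * ∑ j ∈ range n, p ^ j - 4 * ∑ j ∈ range n, (j : ℤ) * p ^ j := by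
  simp only [mul_sum, ← sum_sub_distrib]
  refine sum_congr rfl fun j _ => ?_
  ring

/-- R-tie `(R,L)|(R,L)`, `L = M+1`: `2w = 2·t·p^L` (so `w = p^L·t`). -/
theorem stencil_tie_R (p t : ℤ) (Φ : ℕ → ℤ → ℤ) (F : ℕ → ℕ → ℤ)
    (hodd : ∀ (m : ℕ) (s : ℤ), Φ (2 * m + 1) s = 2 * ∑ j ∈ range (m + 1), (s - 4 * (j : ℤ)) * p ^ j)
    (hF : ∀ S₁ S₂ : ℕ, F S₁ S₂ = Φ (min (2 * S₁ + 1) (2 * S₂ + 1)) (2 * (S₁ : ℤ) + 2 * (S₂ : ℤ) + t)) (M : ℕ) :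
    F (M + 1) (M + 1) - F M (M + 1) - F (M + 1) M + F M M = 2 * (t * p ^ (M + 1)) := by
  have h1 : min (2 * (M + 1) + 1) (2 * (M + 1) + 1) = 2 * (M + 1) + 1 := min_self _
  have h2 : min (2 * M + 1) (2 * (M + 1) + 1) = 2 * M + 1 := by omega
  have h3 : min (2 * (M + 1) + 1) (2 * M + 1) = 2 * M + 1 := by omega
  have h4 : min (2 * M + 1) (2 * M + 1) = 2 * M + 1 := min_self _
  simp only [hF, h1, h2, h3, h4]
  simp only [hodd]
  simp only [sum_affine]
  rw [sum_range_succ (fun j => p ^ j) (M + 1), sum_range_succ (fun j => (j : ℤ) * p ^ j) (M + 1)]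
  push_cast
  ring

/-- U-tie `(U,L)|(U,L)`, `L = M+1`: `2w = p^{L−1}((p+1)t + p + 3)`. -/
theorem stencil_tie_U (p t : ℤ) (Φ : ℕ → ℤ → ℤ) (F : ℕ → ℕ → ℤ)
    (heven : ∀ (m : ℕ) (s : ℤ),
      Φ (2 * m) s = 2 * (∑ j ∈ range m, (s - 4 * (j : ℤ)) * p ^ j) + (s - 4 * (m : ℤ) + 1) * p ^ m)
    (hF : ∀ S₁ S₂ : ℕ, F S₁ S₂ = Φ (min (2 * S₁) (2 * S₂)) (2 * (S₁ : ℤ) + 2 * (S₂ : ℤ) + t)) (M : ℕ) :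
    F (M + 1) (M + 1) - F M (M + 1) - F (M + 1) M + F M M = p ^ M * ((p + 1) * t + p + 3) := by
  have h1 : min (2 * (M + 1)) (2 * (M + 1)) = 2 * (M + 1) := min_self _
  have h2 : min (2 * M) (2 * (M + 1)) = 2 * M := by omega
  have h3 : min (2 * (M + 1)) (2 * M) = 2 * M := by omega
  have h4 : min (2 * M) (2 * M) = 2 * M := min_self _
  simp only [hF, h1, h2, h3, h4]
  simp only [heven]
  simp only [sum_affine]
  rw [sum_range_succ (fun j => p ^ j) M, sum_range_succ (fun j => (j : ℤ) * p ^ j) M]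
  push_cast
  ring

/-- Adjacent mixed kinds `(R,L)|(U,L+1)`, `L = M+1`: `2w = (t+3)p^L`. -/
theorem stencil_adj_RU (p t : ℤ) (Φ : ℕ → ℤ → ℤ) (F : ℕ → ℕ → ℤ)
    (hodd : ∀ (m : ℕ) (s : ℤ), Φ (2 * m + 1) s = 2 * ∑ j ∈ range (m + 1), (s - 4 * (j : ℤ)) * p ^ j)
    (heven : ∀ (m : ℕ) (s : ℤ),
      Φ (2 * m) s = 2 * (∑ j ∈ range m, (s - 4 * (j : ℤ)) * p ^ j) + (s - 4 * (m : ℤ) + 1) * p ^ m)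
    (hF : ∀ S₁ S₂ : ℕ, F S₁ S₂ = Φ (min (2 * S₁ + 1) (2 * S₂)) (2 * (S₁ : ℤ) + 2 * (S₂ : ℤ) + t)) (M : ℕ) :
    F (M + 1) (M + 1 + 1) - F M (M + 1 + 1) - F (M + 1) (M + 1) + F M (M + 1) = (t + 3) * p ^ (M + 1) := by
  have h1 : min (2 * (M + 1) + 1) (2 * (M + 1 + 1)) = 2 * (M + 1) + 1 := by omega
  have h2 : min (2 * M + 1) (2 * (M + 1 + 1)) = 2 * M + 1 := by omega
  have h3 : min (2 * (M + 1) + 1) (2 * (M + 1)) = 2 * (M + 1) := by omega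
  have h4 : min (2 * M + 1) (2 * (M + 1)) = 2 * M + 1 := by omega
  simp only [hF, h1, h2, h3, h4]
  simp only [heven, hodd]
  simp only [sum_affine]
  rw [sum_range_succ (fun j => p ^ j) (M + 1), sum_range_succ (fun j => (j : ℤ) * p ^ j) (M + 1)]
  push_cast
  ring

/-- The realisable case `t = 1` of `stencil_adj_RU`: `2w = 2·(2p^L) = 2φ(R,L) = 2·min(φ(R,L), φ(U,L+1))`. -/
theorem stencil_adj_RU_one (p : ℤ) (Φ : ℕ → ℤ → ℤ) (F : ℕ → ℕ → ℤ)
    (hodd : ∀ (m : ℕ) (s : ℤ), Φ (2 * m + 1) s = 2 * ∑ j ∈ range (m + 1), (s - 4 * (j : ℤ)) * p ^ j)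
    (heven : ∀ (m : ℕ) (s : ℤ),
      Φ (2 * m) s = 2 * (∑ j ∈ range m, (s - 4 * (j : ℤ)) * p ^ j) + (s - 4 * (m : ℤ) + 1) * p ^ m)
    (hF : ∀ S₁ S₂ : ℕ, F S₁ S₂ = Φ (min (2 * S₁ + 1) (2 * S₂)) (2 * (S₁ : ℤ) + 2 * (S₂ : ℤ) + 1)) (M : ℕ) :
    F (M + 1) (M + 1 + 1) - F M (M + 1 + 1) - F (M + 1) (M + 1) + F M (M + 1) = 2 * (2 * p ^ (M + 1)) := by
  rw [stencil_adj_RU p 1 Φ F hodd heven hF M]; ring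

/-- Adjacent mixed kinds `(U,L)|(R,L)`, `L = M+1`: `2w = 2(p+1)p^{L−1} + (t−1)p^L`. -/
theorem stencil_adj_UR (p t : ℤ) (Φ : ℕ → ℤ → ℤ) (F : ℕ → ℕ → ℤ)
    (hodd : ∀ (m : ℕ) (s : ℤ), Φ (2 * m + 1) s = 2 * ∑ j ∈ range (m + 1), (s - 4 * (j : ℤ)) * p ^ j)
    (heven : ∀ (m : ℕ) (s : ℤ),
      Φ (2 * m) s = 2 * (∑ j ∈ range m, (s - 4 * (j : ℤ)) * p ^ j) + (s - 4 * (m : ℤ) + 1) * p ^ m)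
    (hF : ∀ S₁ S₂ : ℕ, F S₁ S₂ = Φ (min (2 * S₁) (2 * S₂ + 1)) (2 * (S₁ : ℤ) + 2 * (S₂ : ℤ) + t)) (M : ℕ) :
    F (M + 1) (M + 1) - F M (M + 1) - F (M + 1) M + F M M = 2 * ((p + 1) * p ^ M) + (t - 1) * p ^ (M + 1) := by
  have h1 : min (2 * (M + 1)) (2 * (M + 1) + 1) = 2 * (M + 1) := by omega
  have h2 : min (2 * M) (2 * (M + 1) + 1) = 2 * M := by omega
  have h3 : min (2 * (M + 1)) (2 * M + 1) = 2 * M + 1 := by omega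
  have h4 : min (2 * M) (2 * M + 1) = 2 * M := by omega
  simp only [hF, h1, h2, h3, h4]
  simp only [heven, hodd]
  simp only [sum_affine]
  rw [sum_range_succ (fun j => p ^ j) M, sum_range_succ (fun j => (j : ℤ) * p ^ j) M]
  push_cast
  ring

/-- The realisable case `t = 1` of `stencil_adj_UR`: `2w = 2(p+1)p^{L−1} = 2φ(U,L) = 2·min(φ(U,L), φ(R,L))`. -/
theorem stencil_adj_UR_one (p : ℤ) (Φ : ℕ → ℤ → ℤ) (F : ℕ → ℕ → ℤ)
    (hodd : ∀ (m : ℕ) (s : ℤ), Φ (2 * m + 1) s = 2 * ∑ j ∈ range (m + 1), (s - 4 * (j : ℤ)) * p ^ j)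
    (heven : ∀ (m : ℕ) (s : ℤ),
      Φ (2 * m) s = 2 * (∑ j ∈ range m, (s - 4 * (j : ℤ)) * p ^ j) + (s - 4 * (m : ℤ) + 1) * p ^ m)
    (hF : ∀ S₁ S₂ : ℕ, F S₁ S₂ = Φ (min (2 * S₁) (2 * S₂ + 1)) (2 * (S₁ : ℤ) + 2 * (S₂ : ℤ) + 1)) (M : ℕ) :
    F (M + 1) (M + 1) - F M (M + 1) - F (M + 1) M + F M M = 2 * ((p + 1) * p ^ M) := by
  rw [stencil_adj_UR p 1 Φ F hodd heven hF M]; ring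

/-- Separated levels, lower side R on the left: `(R,L₁)|(k₂,L₂)` with `2L₁+1 ≤ 2(L₂−1)+e₂` (`L_i = M_i+1`):
`2w = 4p^{L₁} = 2φ(R,L₁)`, for every `t`. -/
theorem stencil_sep_R (p t : ℤ) (e₂ : ℕ) (Φ : ℕ → ℤ → ℤ) (F : ℕ → ℕ → ℤ)
    (hodd : ∀ (m : ℕ) (s : ℤ), Φ (2 * m + 1) s = 2 * ∑ j ∈ range (m + 1), (s - 4 * (j : ℤ)) * p ^ j)
    (hF : ∀ S₁ S₂ : ℕ, F S₁ S₂ = Φ (min (2 * S₁ + 1) (2 * S₂ + e₂)) (2 * (S₁ : ℤ) + 2 * (S₂ : ℤ) + t))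
    (M₁ M₂ : ℕ) (h : 2 * (M₁ + 1) + 1 ≤ 2 * M₂ + e₂) :
    F (M₁ + 1) (M₂ + 1) - F M₁ (M₂ + 1) - F (M₁ + 1) M₂ + F M₁ M₂ = 2 * (2 * p ^ (M₁ + 1)) := by
  have h1 : min (2 * (M₁ + 1) + 1) (2 * (M₂ + 1) + e₂) = 2 * (M₁ + 1) + 1 := by omega
  have h2 : min (2 * M₁ + 1) (2 * (M₂ + 1) + e₂) = 2 * M₁ + 1 := by omega
  have h3 : min (2 * (M₁ + 1) + 1) (2 * M₂ + e₂) = 2 * (M₁ + 1) + 1 := by omega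
  have h4 : min (2 * M₁ + 1) (2 * M₂ + e₂) = 2 * M₁ + 1 := by omega
  simp only [hF, h1, h2, h3, h4]
  simp only [hodd]
  simp only [sum_affine]
  rw [sum_range_succ (fun j => p ^ j) (M₁ + 1), sum_range_succ (fun j => (j : ℤ) * p ^ j) (M₁ + 1)]
  push_cast
  ring

/-- Separated levels, lower side U on the left: `(U,L₁)|(k₂,L₂)` with `2L₁ ≤ 2(L₂−1)+e₂` (`L_i = M_i+1`):
`2w = 2(p+1)p^{L₁−1} = 2φ(U,L₁)`, for every `t`. -/
theorem stencil_sep_U (p t : ℤ) (e₂ : ℕ) (Φ : ℕ → ℤ → ℤ) (F : ℕ → ℕ → ℤ)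
    (heven : ∀ (m : ℕ) (s : ℤ),
      Φ (2 * m) s = 2 * (∑ j ∈ range m, (s - 4 * (j : ℤ)) * p ^ j) + (s - 4 * (m : ℤ) + 1) * p ^ m)
    (hF : ∀ S₁ S₂ : ℕ, F S₁ S₂ = Φ (min (2 * S₁) (2 * S₂ + e₂)) (2 * (S₁ : ℤ) + 2 * (S₂ : ℤ) + t))
    (M₁ M₂ : ℕ) (h : 2 * (M₁ + 1) ≤ 2 * M₂ + e₂) :
    F (M₁ + 1) (M₂ + 1) - F M₁ (M₂ + 1) - F (M₁ + 1) M₂ + F M₁ M₂ = 2 * ((p + 1) * p ^ M₁) := by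
  have h1 : min (2 * (M₁ + 1)) (2 * (M₂ + 1) + e₂) = 2 * (M₁ + 1) := by omega
  have h2 : min (2 * M₁) (2 * (M₂ + 1) + e₂) = 2 * M₁ := by omega
  have h3 : min (2 * (M₁ + 1)) (2 * M₂ + e₂) = 2 * (M₁ + 1) := by omega
  have h4 : min (2 * M₁) (2 * M₂ + e₂) = 2 * M₁ := by omega
  simp only [hF, h1, h2, h3, h4]
  simp only [heven]
  simp only [sum_affine]
  rw [sum_range_succ (fun j => p ^ j) M₁, sum_range_succ (fun j => (j : ℤ) * p ^ j) M₁]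
  push_cast
  ring

/-- Mirror of `stencil_sep_R` (lower side R on the right): `(k₁,L₁)|(R,L₂)` with `2L₂+1 ≤ 2(L₁−1)+e₁`: `2w = 4p^{L₂}`. -/
theorem stencil_sep_R' (p t : ℤ) (e₁ : ℕ) (Φ : ℕ → ℤ → ℤ) (F : ℕ → ℕ → ℤ)
    (hodd : ∀ (m : ℕ) (s : ℤ), Φ (2 * m + 1) s = 2 * ∑ j ∈ range (m + 1), (s - 4 * (j : ℤ)) * p ^ j)
    (hF : ∀ S₁ S₂ : ℕ, F S₁ S₂ = Φ (min (2 * S₁ + e₁) (2 * S₂ + 1)) (2 * (S₁ : ℤ) + 2 * (S₂ : ℤ) + t))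
    (M₁ M₂ : ℕ) (h : 2 * (M₂ + 1) + 1 ≤ 2 * M₁ + e₁) :
    F (M₁ + 1) (M₂ + 1) - F M₁ (M₂ + 1) - F (M₁ + 1) M₂ + F M₁ M₂ = 2 * (2 * p ^ (M₂ + 1)) := by
  have h1 : min (2 * (M₁ + 1) + e₁) (2 * (M₂ + 1) + 1) = 2 * (M₂ + 1) + 1 := by omega
  have h2 : min (2 * M₁ + e₁) (2 * (M₂ + 1) + 1) = 2 * (M₂ + 1) + 1 := by omega
  have h3 : min (2 * (M₁ + 1) + e₁) (2 * M₂ + 1) = 2 * M₂ + 1 := by omega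
  have h4 : min (2 * M₁ + e₁) (2 * M₂ + 1) = 2 * M₂ + 1 := by omega
  simp only [hF, h1, h2, h3, h4]
  simp only [hodd]
  simp only [sum_affine]
  rw [sum_range_succ (fun j => p ^ j) (M₂ + 1), sum_range_succ (fun j => (j : ℤ) * p ^ j) (M₂ + 1)]
  push_cast
  ring

/-- Mirror of `stencil_sep_U` (lower side U on the right): `(k₁,L₁)|(U,L₂)` with `2L₂ ≤ 2(L₁−1)+e₁`: `2w = 2(p+1)p^{L₂−1}`. -/
theorem stencil_sep_U' (p t : ℤ) (e₁ : ℕ) (Φ : ℕ → ℤ → ℤ) (F : ℕ → ℕ → ℤ)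
    (heven : ∀ (m : ℕ) (s : ℤ),
      Φ (2 * m) s = 2 * (∑ j ∈ range m, (s - 4 * (j : ℤ)) * p ^ j) + (s - 4 * (m : ℤ) + 1) * p ^ m)
    (hF : ∀ S₁ S₂ : ℕ, F S₁ S₂ = Φ (min (2 * S₁ + e₁) (2 * S₂)) (2 * (S₁ : ℤ) + 2 * (S₂ : ℤ) + t))
    (M₁ M₂ : ℕ) (h : 2 * (M₂ + 1) ≤ 2 * M₁ + e₁) :
    F (M₁ + 1) (M₂ + 1) - F M₁ (M₂ + 1) - F (M₁ + 1) M₂ + F M₁ M₂ = 2 * ((p + 1) * p ^ M₂) := by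
  have h1 : min (2 * (M₁ + 1) + e₁) (2 * (M₂ + 1)) = 2 * (M₂ + 1) := by omega
  have h2 : min (2 * M₁ + e₁) (2 * (M₂ + 1)) = 2 * (M₂ + 1) := by omega
  have h3 : min (2 * (M₁ + 1) + e₁) (2 * M₂) = 2 * M₂ := by omega
  have h4 : min (2 * M₁ + e₁) (2 * M₂) = 2 * M₂ := by omega
  simp only [hF, h1, h2, h3, h4]
  simp only [heven]
  simp only [sum_affine]
  rw [sum_range_succ (fun j => p ^ j) M₂, sum_range_succ (fun j => (j : ℤ) * p ^ j) M₂]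
  push_cast
  ring

end Summit.HodgeConjecture.HodgeConjecture.HodgeLocus.Census.GKStencilClosedForms
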